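import Mathlib
import Summits.Ventures.PercRepro2.Independence
import Summits.Ventures.PercRepro2.Harris
import Summits.Ventures.PercRepro2.HCov
import Summits.Ventures.PercRepro2.CutVertexPaths
import Summits.Ventures.PercRepro2.CutOneFarConn
import Summits.Ventures.PercRepro2.CutTwoFarConn
import Summits.Ventures.PercRepro2.CutTwoFarLaw
import Summits.Ventures.PercRepro2.CutTwoFar
import Summits.Ventures.PercRepro2.CutTwoFarHarris
import Summits.Ventures.PercRepro2.CutTwoFarRootsLaw
import Summits.Ventures.PercRepro2.CutTwoFarRightPat
import Summits.Ventures.PercRepro2.PendantRoot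
import Summits.Ventures.PercRepro2.CutTwoFarOAConn
import Summits.Ventures.PercRepro2.CutTwoFarOAMasses

/-!
# `o` and `a₃` behind a cut vertex, III: THE CROSS-COVARIANCE FORM (blind cell PercRepro2,
typer-1 g50)

The class theorem T2 of MINE2-CUTVERTEX.md §13.2 (S3.5, the role pair `{o, a₃}`) in the kernel:
with `v` a cut vertex, `o, a₃` on the left and `a₁, a₂, b` on the right (or at `v`),

  `Gc = −2 · P_A(o ↔ v, a₃ ↮ v) · P(Q) · [covC(bL, vH) + covC(bH, vL)]`

(**`Gc_oa3Far_eq`**), with `covC` the cleared covariance under `Q = {a₁ ↮ a₂}` of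
`PendantRoot.lean` and `bL = {a₁ ↔ b}`, `vH = {a₂ ↔ v}`, `bH = {a₂ ↔ b}`, `vL = {a₁ ↔ v}`; the
joint law of `(o, a₃)` in the part enters only through `q_x1 = P_A(o ↔ v, a₃ ↮ v)`.  Hence (HCOV)
on the whole class (**`HCov_oa3Far`**): both cross covariances are `≤ 0` by BHK06 Thm 1.3
(`PendantRoot.covC_cross_nonpos`).  Proof: the bilinear forms of Part II, `∑ q = 1`, `∑ r = 1`,
and `ring`.  Own work; standard axioms.
-/

namespace Summit.Ventures.PercRepro2

open CovForm CutVertexM9 UnionCluster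

namespace CutTwoFar

section OAFar

variable {V : Type*} {E : Type*} [Fintype E] [DecidableEq E] {R : Type*} [Field R]
variable {ends : E → Sym2 V} {side : E → Bool} {L : Set V} {v : V} {Rt : Set V}

variable (h : CutVertex ends side L v Rt) {o b a₁ a₂ a₃ : V} (p : E → R)
include h

/-- **T2 — THE CROSS-COVARIANCE FORM** (MINE2-CUTVERTEX §13.2; S3.5 `{o, a₃}`): with `o, a₃`
behind the cut vertex `v`, `Gc = −2 · q_x1 · P(Q) · [covC(bL, vH) + covC(bH, vL)]`. -/
theorem Gc_oa3Far_eq (ho : o ∈ L ∨ o = v) (h3 : a₃ ∈ L ∨ a₃ = v) (h1 : a₁ ∈ Rt ∨ a₁ = v)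
    (h2 : a₂ ∈ Rt ∨ a₂ = v) (hb : b ∈ Rt ∨ b = v) : Gc p ends o a₁ a₂ a₃ b =
    -2 * patProb ends side v o a₃ p ![true, false, false] * prob p (avoidAll ends a₂ {a₁}) *
      (PendantRoot.covC p ends a₁ a₂ (connEvent ends a₁ b) (connEvent ends a₂ v) +
        PendantRoot.covC p ends a₁ a₂ (connEvent ends a₂ b) (connEvent ends a₁ v)) := by
  have hq := sum_patProb_transPatterns ends side v o a₃ p
  rw [sum_transPatterns] at hq
  have hr := ratom_sum_transSix ends side v a₁ a₂ b p
  rw [sum_transSix] at hr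
  have hqs : patProb ends side v o a₃ p ![false, false, false] = 1 - (patProb ends side v o a₃ p ![true, true, true] + patProb ends side v o a₃ p ![true, false, false] + patProb ends side v o a₃ p ![false, true, false] + patProb ends side v o a₃ p ![false, false, true]) := by
    linear_combination hq
  have hrs : ratom ends side v a₁ a₂ b p ![false, false, false, false, false, false] = 1 - (ratom ends side v a₁ a₂ b p ![true, true, true, true, true, true] + ratom ends side v a₁ a₂ b p ![true, true, false, true, false, false] + ratom ends side v a₁ a₂ b p ![true, false, true, false, true, false] + ratom ends side v a₁ a₂ b p ![true, false, false, false, false, true] + ratom ends side v a₁ a₂ b p ![true, false, false, false, false, false] + ratom ends side v a₁ a₂ b p ![false, true, true, false, false, true] + ratom ends side v a₁ a₂ b p ![false, true, false, false, true, false] + ratom ends side v a₁ a₂ b p ![false, true, false, false, false, false] + ratom ends side v a₁ a₂ b p ![false, false, true, true, false, false] + ratom ends side v a₁ a₂ b p ![false, false, true, false, false, false] + ratom ends side v a₁ a₂ b p ![false, false, false, true, true, true] + ratom ends side v a₁ a₂ b p ![false, false, false, true, false, false] + ratom ends side v a₁ a₂ b p ![false, false, false, false, true, false] + ratom ends side v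 a₁ a₂ b p ![false, false, false, false, false, true]) := by
    linear_combination hr
  simp only [Gc, DEF, PendantRoot.covC]
  rw [PQ_oa h p h1 h2,
    D_oa h p h3 h1 h2,
    Do_oa h p ho h3 h1 h2,
    EQbo_oa h p ho h1 h2 hb,
    EQb3_oa h p h3 h1 h2 hb,
    EQb3o_oa h p ho h3 h1 h2 hb,
    gap_oa h p h1 h2 hb,
    EQo_oa h p ho h1 h2,
    EQ3_oa h p h3 h1 h2,
    EQ3o_oa h p ho h3 h1 h2,
    PDb_oa h p h3 h1 h2 hb,
    PDbo_oa h p ho h3 h1 h2 hb,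
    cBV1 h p h1 h2 hb,
    cB1 h p h1 h2 hb,
    cV2 h p h1 h2,
    cBV2 h p h1 h2 hb,
    cB2 h p h1 h2 hb,
    cV1 h p h1 h2, hqs, hrs]
  ring

/-- **(HCOV) with `o` and `a₃` behind a cut vertex**, every admissible weight vector: the two
cross-cluster BHK slacks are `≤ 0`. -/
theorem HCov_oa3Far [Fintype V] [DecidableEq V] [LinearOrder R] [IsStrictOrderedRing R]
    (ho : o ∈ L ∨ o = v) (h3 : a₃ ∈ L ∨ a₃ = v) (h1 : a₁ ∈ Rt ∨ a₁ = v) (h2 : a₂ ∈ Rt ∨ a₂ = v)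
    (hb : b ∈ Rt ∨ b = v) (hp : IsProbVec p) : HCov p ends o a₁ a₂ a₃ b := by
  unfold HCov
  rw [Gc_oa3Far_eq h p ho h3 h1 h2 hb]
  obtain ⟨c1, c2⟩ := PendantRoot.covC_cross_nonpos p ends hp b a₁ a₂ v
  have hq : 0 ≤ patProb ends side v o a₃ p ![true, false, false] := prob_nonneg hp _
  have hPQ := prob_nonneg hp (avoidAll ends a₂ {a₁})
  have h2' : (0 : R) ≤ 2 := by norm_num
  have : -2 * patProb ends side v o a₃ p ![true, false, false] * prob p (avoidAll ends a₂ {a₁}) *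
      (PendantRoot.covC p ends a₁ a₂ (connEvent ends a₁ b) (connEvent ends a₂ v) +
        PendantRoot.covC p ends a₁ a₂ (connEvent ends a₂ b) (connEvent ends a₁ v)) =
      2 * patProb ends side v o a₃ p ![true, false, false] * prob p (avoidAll ends a₂ {a₁}) *
      (-(PendantRoot.covC p ends a₁ a₂ (connEvent ends a₂ b) (connEvent ends a₁ v)) +
        -(PendantRoot.covC p ends a₁ a₂ (connEvent ends a₁ b) (connEvent ends a₂ v))) := by ring
  rw [this]
  exact mul_nonneg (mul_nonneg (mul_nonneg h2' hq) hPQ)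
    (add_nonneg (neg_nonneg.2 c1) (neg_nonneg.2 c2))

end OAFar

end CutTwoFar

end Summit.Ventures.PercRepro2
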